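import Mathlib
import HarnessLib
import HarnessLib.Audit
import Summits.AnomalousDissipation.Statement
import Literature.Analysis.FluidPDE.StatisticalSolution
import Literature.Analysis.FluidPDE.StokesTorus
import Summits.AnomalousDissipation.AnomalousDissipation.Theorems.TaylorCertificatesSteadyStatesLoudBoundedStubGpAdmissible
import HarnessLib.Audit.Status.Attr

/-!
Route: EnsembleRigidity

DORMANT since 2026-08-26T16:12:49Z (reconciler: no traction for 6.2 d (last activity item-proof-filed at 2026-08-20T11:59:43Z); parked, not closed — `ledger route dormant route-AnomalousDissipation-EnsembleRigidity --off` to reactivate) — unstaffed, not closed; items shared with open routes are served there. `ledger route dormant <id> --off` reactivates.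

# Route EnsembleRigidity — statistical Lamb rigidity — every tame Euler statistics of f_GP is rough,
so every mean-bounded Leray–Hopf family is loud

RECOMBINATION (lens recomb, cycle 1). Pin the Galloway–Proctor force f_GP(x) = sin(2πx₂)e₀ +
sin(2πx₀)e₁ + sin(2πx₁)e₂ (inline sum of
three Stokes modes, byte-identical to FrustratedForces / VirtualDissipation / TaylorCertificates).
It suffices to show X = X1 ∧ X2:
(X1, GPStatisticalRigidity — STATISTICAL LAMB RIGIDITY, ν-free) for every energy level E there are
c, δ₀ > 0 such that every Borel
probability measure μ on H = L²_σ(T³) with finite mean enstrophy G = ∫‖∇v‖²dμ, mean energy ∫|v|²dμ ≤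
E, non-negative work on every
energy shell, and forced-EULER generator defect |∫⟨f_GP − B(v,v), Φ'(v)⟩dμ| ≤ R·(∫‖∇Φ'(v)‖²dμ)^{1/2}
for all cylindrical Φ with
R ≤ δ₀, pays c ≤ R·G^{1/2} ("a statistics that nearly balances f_GP must be rough; at R = 0: f_GP
has no finite-enstrophy stationary Euler
statistics at any energy"); (X2, GPMeanBoundedFamily — TURBULENT SATURATION IN THE MEAN) along some
ν_j → 0 there are global
Leray–Hopf solutions of NS_{ν_j}(f_GP) with H-valued lifts (zero momentum, weakly solenoidal slices)
and limsup-mean energy ≤ E.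
Bridge (banked, two provable items): a stationary statistical solution of NS_ν has Euler defect
EXACTLY ν∫(∇v,∇Φ')dμ, so R = ν G^{1/2}
and R·G^{1/2} = νG = ε(μ) (ResidualTransferSSS: VirtualDissipation's residual × roughness =
dissipation, lifted from steady states to
measures); hence every SSS of f_GP with mean energy ≤ E has ε(μ) ≥ min(c, δ₀²) for ν ≤ 1, and
time-average measures carry this floor to
the limsup-mean dissipation of every lifted Leray–Hopf path with meanEnergy ≤ E
(EnsembleFloorTransfer, FMRT Ch. IV Thm 3.1 in tree).
Cards: euler-coercive-force (spine, its C1/C2 architecture with the audited gap of its soft bridge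
closed), virtual-dissipation-magic-cone
(the lever), forced-small-scales-h1-coercivity-wad-rung and frustrated-forces-resonant-skeletons
(object and force).
JUDGE-REPAIR (rev 3, 2026-08-17). X1 is no longer assumed whole: it is DERIVED inside `closes` from
two cruxes, T = GPTameDefectFloor — the TAME DEFECT FLOOR (a ν-free lower bound r(E,G₁) > 0 on the
cylindrical forced-Euler defect of every probability measure with mean energy ≤ E and mean enstrophy
≤ G₁: the judge's `what_would_move_it`, now named and load-bearing) — and R = TameToRough (the
conditional Onsager calibration above a roughness threshold G₁(E), shared with route
TameRoughRigidity, stmt-18401), via the proved patching T → R → X1 (support TameSplit; δ₀' = min δ₀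
(r/2) makes the tame case vacuous). X1 = GPStatisticalRigidity stays as this route's target (the
sibling route decomposes T further as GPEulerCoercive ∧ TameClosure). So it suffices to show T ∧ R ∧
X2.
Lean: `GPTameDefectFloor ∧ TameToRough ∧ GPMeanBoundedFamily` (crux decls below; `closes :
GPTameDefectFloor → TameToRough → GPMeanBoundedFamily → ResidualTransferSSS → EnsembleFloorTransfer
→ AnomalousDissipation` is PROVED in the route file, rev 3, native OK, axioms propext /
Classical.choice / Quot.sound; the last two hypotheses are the landed bridge items stmt-15510/15511)

## Assembly
Pure logic plus the landed admissibility of f_GP (Theorems…StubGpAdmissible.stub_gpAdmissible),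
PROVED in glue.lean / Sketch.lean
(rc 0, standard axioms): first X1 := TameSplit T R (inline: R fed with T calibrates above G₁(E); T
at (E, G₁(E)) gives r; δ₀' = min δ₀ (r/2)); then take (E, ν_j, u_j, U_j) from GPMeanBoundedFamily
and (c, δ₀) from X1 at level E; put
ε₀ = min(c, δ₀²). For ν ∈ (0,1] and an SSS μ of (ν, f_GP) with integrable energy ≤ E,
ResidualTransferSSS supplies shell positivity and
the defect bound with R = ν G^{1/2} (G = mean enstrophy, finite); if R ≤ δ₀ rigidity gives c ≤ R
G^{1/2} = νG = ensembleDissipation, else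
νG = R²/ν ≥ R² > δ₀²; so ensembleDissipation ≥ ε₀. EnsembleFloorTransfer turns this into
meanDissipation (ν_j) (u_j) ≥ ε₀ for every j;
the witnesses of Literature.Turb.ZerothLaw are (f_GP, ν, u₀, u, E, ε₀).

Rationale: WHY THIS LINE. Recombine three banked learnings. (i) VirtualDissipation's identity "Euler residual ×
roughness = dissipation" is exact not only at steady
states but for EVERY stationary statistical solution (FMRT2001 Ch. IV (1.30): ∫⟨f − νAv − B(v,v),
Φ'(v)⟩dμ = 0, so the forced-Euler defect
of μ is ν∫(∇v,∇Φ'(v))dμ ≤ νG^{1/2}‖∇Φ'‖_{L²(μ)}), which lets the rigidity half speak about MEASURES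
and deletes the existence of light
STEADY states (VirtualDissipation X2, frozen turbulence) from the route. (ii) ForcedSmallScales' /
card euler-coercive-force's object —
non-existence of finite-enstrophy stationary Euler statistics of the force — is made QUANTITATIVE (c
≤ R G^{1/2}), which deletes the rate-
rigidity crux (FSS C3), the enstrophy-dichotomy compactness step and the weak-limit step of the
card's bridge that its novelty audit found
false as stated ((B(u,u),w) is not weakly continuous; CTV2013 arXiv:1305.7089 needed uniform
H^{1/2}): the inequality is applied at each
ν_j separately, no limit measure is ever formed — this is K41 item (ii) of
Friedlander–Glatt-Holtz–Vicol (arXiv:1404.1098 §2.3 p.6, "an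
outstanding open problem") attacked WITHOUT their item (iii). (iii) The refutation lessons
(negatives 2979/2984/0204: Galilean drift;
2859: unpinned slices) are honoured by typing: H-lifts and time averages only. What the pair buys
that no parent had: the existence half is
the weakest on the summit (mean-bounded lifted LH family of a pinned force — DoeringFoias2002 §3
saturation; implied by FSS 1435 at f_GP,
by GPLoudEnergyCeilingZ ∧ GPLoudFamilyZ of FrustratedForces, and by any bounded steady/periodic GP
branch), NO leakage / energy-equality
crux is needed (the SSS energy inequality has the right sign and dissipation enters only through
lower semicontinuity), and the hard half is
ν-free and steady-state-free. Imported areas: statistical solutions (FMRT2001 Ch. IV–V;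
Foias–Rosa–Temam arXiv:1606.02174), the dual side
of auxiliary-functional minimax (Rosa–Temam arXiv:2010.06730), Onsager-threshold calibration of the
adversary (mollified C^σ dodgers cost
R G^{1/2} ≍ ℓ^{3σ−1}); solved sibling: the forced dyadic model, where "every inviscid statistics
dissipates" IS the zeroth law
(Cheskidov–Friedlander arXiv:0810.3718).

RANKED CRUXES. #2 GPTameDefectFloor (crux, NEW rev 3 — the judge's item) — TAME DEFECT FLOOR OF
f_GP: for every energy level E and mean-enstrophy level G₁ there is r(E,G₁) > 0 such that no Borel
probability measure on H with Integrable |v|², ensembleEnergy ≤ E and ensembleEnstrophy ≤ ofReal G₁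
has Φ-uniform cylindrical forced-Euler defect ≤ r. Strictly weaker than X1 (X1 ⇒ T after
desaturation), exactly the premise of R, implied by the sibling's N ∧ K. WHY EASIER THAN X1: the
enstrophy budget fixes the roughness scale — ONE Farkas-dual cylindrical certificate at the single
scale Λ(E,G₁) (the X-line's W2 shape WITHOUT the Λ-uniformity on which its C2 is stuck) gives the
gap by the landed weakDuality2_integrate; below the linear horizon E < 3/(4π) T is PROVED
(gpRigid_smallEnergy); the first informative target is one level E ∈ [0.3, 1] at every G₁ — a
fixed-scale SDP/SOS feasibility problem per (E, G₁, K) on a Galerkin band (birth skeleton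
Lines/birth.lean: stub_tameWeakDuality [provable now] + stub_tameCertificates [open] +
GPTameDefectFloor_of [proved]). [difficulty: open-problem] (why it might fail: one exact TAME dodger
kills it at its (E,G₁) — a converged K→∞ limit of the census' steady Galerkin dodger branch (E≈1,
G_min(K) = 82→436 at K ≤ 14), a ≥3-shell Beltrami cancellation, an orbit measure of a recurrent tame
Euler flow.) [arXiv:1404.1098, FoiasManleyRosaTemam2001, arXiv:2110.08039, arXiv:2010.06730,
arXiv:1705.07096,
Summits/AnomalousDissipation/AnomalousDissipation/Cruxes/GPStatisticalRigidity/Disproof.lean,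
Summits/AnomalousDissipation/AnomalousDissipation/Theses/TameRoughRigidity.lean]
#6 TameToRough (crux, NEW here rev 3; = TameRoughRigidity stmt-18401, shared) — CONDITIONAL ONSAGER
CALIBRATION: if every tame class (E,G₁) carries a defect gap, then for every E there are G₁, c, δ₀ >
0 such that every admissible μ with ensembleEnstrophy ≥ ofReal G₁, shell work ≥ 0 and defect ≤ R ≤
δ₀ pays c ≤ R√G — the rough half of X1, conditioned on T so that it does not re-contain the
existence question. [difficulty: open-problem] (why it might fail: a genuinely rough violating
sequence — mollifications of a B^(σ>1/3) stationary Euler statistics of f_GP with vanishing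
Duchon–Robert defect, R√G ≍ ℓ^(3σ−1) → 0.) [arXiv:1706.04113, doi:10.1007/bf02099744,
arXiv:1404.1098, Literature.Barriers.AnomalousDissipation.DrivasEyink2019_lemma1_measurable]
#9 TameSplit (support, provable now; proof attached as evidence on stmt-17939 and inlined in
`closes`) — T → R → X1.
#0 GPStatisticalRigidity (target since rev 3; was crux #2) — STATISTICAL LAMB RIGIDITY OF f_GP (new;
from VirtualDissipation: the residual lever, now on measures; from ForcedSmallScales 1434/1440 and
card euler-coercive-force: the object, now quantitative and level-wise). For every E there are c, δ₀
> 0 such that every Borel probability measure μ on Torus.energySpace (Fin 3) with Integrable |v|²,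
ensembleEnergy μ ≤ E, ensembleEnstrophy μ < ⊤, non-negative work ∫_{e₁≤|v|²<e₂}(v,f_GP)dμ ≥ 0 on
every energy shell, and cylindrical forced-Euler defect |∫ nsGeneratorPairing 0 f_GP v (Φ.grad v)
dμ| ≤ R·(∫ gradNormSq (Φ.grad v) dμ)^{1/2} for all Φ (integrand integrable), 0 ≤ R ≤ δ₀, satisfies c
≤ R·((ensembleEnstrophy μ).toReal)^{1/2}. At a Dirac mass this is VirtualDissipation's single-field
rigidity at level E (plus (f,v) ≥ 0); at R = 0 it says f_GP carries no finite-enstrophy stationary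
Euler statistics of mean energy ≤ E (the FMRT class of FSS's CyclicForceCoercive, GP orientation).
[difficulty: open-problem] (why it might fail: One tame Euler statistics of f_GP kills it at its
level: a bounded quiet dodger end of the GP Galerkin census (K² ∈ {6,11,12,14}, continuum fate
open), a convergent Beltrami big-dodger series A·ABC⁺ + O(1/A), a C^{σ>1/3} standing flow; or
IDES2025's vanishing anomaly.) [arXiv:1404.1098, arXiv:0810.3718, arXiv:1305.7089, arXiv:2010.06730,
arXiv:2504.13298, doi:10.1137/140957354, FoiasManleyRosaTemam2001,
Summits/AnomalousDissipation/AnomalousDissipation/Theses/VirtualDissipation.lean,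
Summits/AnomalousDissipation/AnomalousDissipation/Ideas/euler-coercive-force.md]
#3 GPMeanBoundedFamily (crux) — TURBULENT SATURATION IN THE MEAN FOR f_GP (from Correlation 14641 /
ForcedSmallScales 1435: the saturation half, pinned to f_GP, weakened from pathwise to limsup-mean,
momentum killed by the H-lift as the drift refutations 2979/2984/0204 demand). There are a level E,
viscosities ν_j ∈ (0,1] with ν_j → 0, data u₀ⱼ, global Leray–Hopf solutions u_j of NS_{ν_j}(f_GP)
and H-valued lifts U_j (U_j t = u_j t a.e. for every t ≥ 0: zero momentum, weakly solenoidal slices)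
with meanEnergy (u_j) ≤ E for all j. Any zero-momentum bounded family — turbulent paths from rest, a
bounded steady or periodic GP branch realised as Leray–Hopf — fires it. [difficulty: open-problem]
(why it might fail: No ν-uniform mean-energy bound is known for ANY fixed 3-D force at zero momentum
(a priori ⟨|u|²⟩ ≤ |f|²/(16π⁴ν²) only); every GP family might laminarise onto runaway branches
(census: quiet Stokes-arc ends with ‖u‖ ≍ ν^{-1/3}), making E grow with j.) [DoeringFoias2002,
FoiasManleyRosaTemam2001, arXiv:2311.04182, arXiv:1305.7089,
Summits/AnomalousDissipation/AnomalousDissipation/Theses/Correlation.lean,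
Summits/AnomalousDissipation/AnomalousDissipation/Theorems/CorrelationEnergyUnboundedNegRefutation.lean]
#4 ResidualTransferSSS (crux) — RESIDUAL TRANSFER AT THE ENSEMBLE LEVEL (banked lever of
VirtualDissipation lifted to measures; provable now, it is the engine so it is ranked). For ν > 0, f
smooth divergence-free mean-zero and every stationary statistical solution μ of NS_ν(f) with
integrable energy: (a) the work is non-negative on every energy shell (the FMRT shell inequality
∫_{shell}(ν‖∇v‖² − (f,v))dμ ≤ 0 with ν‖∇v‖² ≥ 0, both terms integrable); (b) for every cylindrical Φ
the forced-Euler generator integrand nsGeneratorPairing 0 f v (Φ.grad v) is μ-integrable and |∫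
nsGeneratorPairing 0 f v (Φ.grad v) dμ| ≤ ν·((ensembleEnstrophy μ).toReal)^{1/2}·(∫ gradNormSq
(Φ.grad v) dμ)^{1/2}. Proof: nsGeneratorPairing ν − nsGeneratorPairing 0 = ν(v, ΔΦ'(v)) pointwise
(definition); the generator identity (1.30) gives ∫ nsGeneratorPairing 0 = −ν∫(v,ΔΦ'(v)); spectral
Green–Cauchy–Schwarz |(v,Δw)| ≤ (eGradNormSq v)^{1/2}‖∇w‖ μ-a.e. (finite enstrophy), then
Cauchy–Schwarz in μ. [difficulty: M] (why it might fail: Provable in kind; typing risks only: the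
spectral Green bound |(v,Δw)| ≤ ‖∇v‖‖∇w‖ for v ∈ H with eGradNormSq v < ⊤ may need a new Literature
lemma (PhantomFloor.abs_integral_inner_laplacian_le is stated for smooth v).)
[FoiasManleyRosaTemam2001, arXiv:1606.02174,
Summits/AnomalousDissipation/AnomalousDissipation/Theorems/TaylorCertificatesPhantomFloorLawPairing.lean,
Summits/AnomalousDissipation/AnomalousDissipation/Theses/VirtualDissipation.lean]
#5 EnsembleFloorTransfer (crux) — ENSEMBLE FLOOR ⇒ PATH FLOOR (the dissipation twin of
TaylorCertificates' PROVED EnsembleCeilingTransfer; provable now with in-tree FMRT Ch. IV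
machinery). For ν > 0, f smooth divergence-free mean-zero: if every stationary statistical solution
of NS_ν(f) with integrable energy and ensembleEnergy ≤ E has ensembleDissipation ≥ ε₀, then every
global Leray–Hopf u (datum u₀) with an H-valued lift U (U t = u t a.e., t ≥ 0) and meanEnergy u ≤ E
has meanDissipation ν u ≥ ε₀. Proof: any generalized limit Λ; time-average measure μ of U
(exists_timeAverageMeasure_holds); μ is an SSS (timeAverage_isStationary_holds; force fed through
its H-class as in EnsembleCeilingTransfer_proof); ∫min(|v|²,M)dμ ≤ limsup Cesàro mean of ‖U t‖² =
meanEnergy u ≤ E, M → ∞ gives integrability and ensembleEnergy ≤ E; ν∫min(galerkinEnstrophy_m, M)dμ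
≤ limsup Cesàro mean of ν(eGradNormSq (u t)).toReal = meanDissipation (galerkinEnstrophy ≤
eGradNormSq, finite a.e. in t; pattern of IsTimeAverageMeasure.lintegral_eGradNormSq_le), monotone
convergence and Fatou give ensembleDissipation ν μ ≤ meanDissipation ν u. [difficulty: L] (why it
might fail: Provable in kind; typing risk: the limsup junk of meanEnergy/meanDissipation on
unbounded Cesàro means (value 0) — harmless for Leray–Hopf paths at ν > 0 (Doering–Foias a-priori
bounds in tree), but the proof must route through them.) [FoiasManleyRosaTemam2001,
DoeringFoias2002,
Summits/AnomalousDissipation/AnomalousDissipation/Theorems/TaylorCertificatesEnsembleCeilingTransfer.lean,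
Literature/Analysis/FluidPDE/TimeAverageEnstrophy.lean]

TWO-LAYER PLAN. Foreseen, NOT filed. GPStatisticalRigidity ⇐ (NoTameGPStatistics: the R = 0 case —
no finite-enstrophy forced-Euler SSS of f_GP of mean
energy ≤ E, = FSS's CyclicForceCoercive in GP orientation, level-wise) → (OnsagerUpgrade: for a
force with no tame statistics below level E,
defect-small measures concentrate — c(E), δ₀(E) exist by a concentration-compactness argument at the
Onsager threshold R G^{1/2} → 0) →
GPStatisticalRigidity, k = 2, once ResidualTransferSSS closes. Alternative dual child: a ν-FREE
cylindrical certificate Ψ with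
⟨f_GP − B(v,v), Ψ'(v)⟩ ≥ c₁ − c₂‖∇v‖·‖∇Ψ'(v)‖ on {|v|² ≤ E'} (Rosa–Temam minimax side).
GPMeanBoundedFamily ⇐ (GPLiftFromRest: lifted
Leray–Hopf existence from zero-momentum data, routine Galerkin as in symmetricLhExistence_proof /
ZeroDatumLerayHopf_proof) →
(GPMeanCeilingFromRest: limsup-mean energy of THAT construction bounded uniformly in ν) →
GPMeanBoundedFamily, k = 2.

KILL CRITERIA. A finite-enstrophy stationary Euler statistics of f_GP (Dirac at an exact steady
dodger of any energy, an orbit measure of a smooth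
recurrent forced-Euler flow, or a converged continuum limit of the census' bounded quiet dodger
ends) refutes GPStatisticalRigidity at every
level ≥ its mean energy: close `refuted:GPStatisticalRigidity` if that energy is below every level
reachable by bounded GP families
(substantive); if it only bites above, nothing load-bearing dies but tenure re-types X1 below that
level as a NEW item (one pre-registered
pivot). A proof that every zero-momentum GP Leray–Hopf family has meanEnergy → ∞
(EnergyUnboundedNegZM 14642 at f_GP) refutes
GPMeanBoundedFamily: close `refuted:GPMeanBoundedFamily` (no force pivot inside this route — a
different pinned force is a new route).
Neg.NegThesis (0228) or FSS's UniversalDodgers (1437) proved kills the line. VirtualDissipation's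
LambRigidGP refuted at level ≤ 2 by an
EXACT dodger refutes X1 too (shared enemy); refuted by a near-dodger SEQUENCE only (R → 0, R‖∇U‖ → 0
with (f,U) < 0 allowed) does not
automatically. Mooted by: GPZerothLaw (FrustratedForces 2976), SteadyStatesLoudBounded
(TaylorCertificates), or the summit elsewhere.

NOT DECOMPOSED YET. (Filed at rev 3: X1 ⇐ T ∧ R with proved patching; T ⇐ N ∧ K is route
TameRoughRigidity.) Still not filed: the level-wise children of T (T at one level E₀ ∈ [0.3, 1], all
G₁ — the judge's 'even at one energy level'; they are stubs of T's lines, not items); the dual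
ν-free certificate child; the
lifted-existence-from-rest half of X2 (routine) versus its mean ceiling (the content); the
orientation bridge f_GP ↔ FSS's cyclic force
1440 (axis swap, an isometry of T³ — a support item once either side moves); symmetry-class (Fix K /
cyclic-permutation class) restrictions
of X1, deliberately NOT used here (PumpedMirror's arena; the sibling recomb seat opened it this
cycle); a named Literature predicate
`Torus.EulerDefectLE f μ R` shortening X1 and item 4 (definition request below, not load-bearing).

CHEAPEST FALSIFIER. Continue the hub's Galerkin census of the f_GP steady variety (kit j001684 /
j001712 / j001732, card big-dodgers-odd-puiseux-ladder) in
the truncation K: the bounded QUIET dodger ends seen at K² ∈ {6, 11, 12, 14} either converge (energy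
and H⁻¹ Euler residual R_K → 0 with
R_K‖∇U_K‖ → 0 as K → ∞) — an exact finite-energy dodger, X1 dead at that level — or run away / stall
at R_K‖∇U_K‖ ≳ const (supports X1).
Second: VirtualDissipation's L-BFGS quiet-point search for f_GP at energy caps 1–4 and degree 8–12
(pattern of j014325): a residual
plateau decreasing with the degree at bounded virtual dissipation kills X1. Neither could be run
from this compute-free planner seat; both
are one refuter day. In-head checks done: Dirac at t·f_GP, at A·ABC^± and at 0 all have defect
bounded below at fixed level (f_GP is not
Euler-steady, (f·∇)f is not a gradient; Beltrami rays have P Λ = 0); random-phase two-mode ensembles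
balance the MEAN stress of any force
but are not stationary beyond order 1 (work on shells, cubic transfer), so they do not meet the
cylindrical defect bound.

NUMBERS. ‖f_GP‖₂² = 3/2, ‖f_GP‖_{Ḣ⁻¹} = (3/2)^{1/2}/(2π) ≈ 0.195 (unit torus) — below mean energy
‖f‖⁴/(‖∇f‖_∞… ) ≈ 0.24 no measure has small
defect (Doering–Foias, test Φ' = f_GP), so X1 is vacuous-true at very low levels;
VirtualDissipation's near-dodger data: energy 2.31,
R = 0.030, R‖∇v‖ = 0.43; L-BFGS plateau R ≈ 7·10⁻³ at energy ≈ 0.6, degree 4–6 (⇒ c(0.6) ≲ 0.2);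
primary steady GP branch E ≈ 0.86,
ε ≈ 0.375 at μ ≈ 1.8·10⁻³ (NumericsJ006377); laminar a-priori ceiling 3/(32π⁴ν²); Onsager
calibration R G^{1/2} ≍ ℓ^{3σ−1} for
mollified C^σ dodgers; in `closes`: ε₀ = min(c, δ₀²), R_j = (ν_j ε_j)^{1/2}. Items at open: 5 (4
cruxes + assembly).

DEFINITION REQUESTS. Optional, not load-bearing: `Literature.Analysis.FluidPDE.Torus.EulerDefectLE
(f) (μ) (R) : Prop` := the cylindrical defect clause of
X1/item 4 (∀ Φ, Integrable … ∧ |∫ nsGeneratorPairing 0 f v (Φ.grad v) ∂μ| ≤ R * sqrt (∫ gradNormSq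
(Φ.grad v) ∂μ)), topic
Literature/Analysis/FluidPDE, to shorten both items and their children; and the spectral Green bound
|(v, Δw)| ≤ (eGradNormSq v)^{1/2}‖∇w‖
for v ∈ H as a Literature lemma (cite FMRT2001 Ch. II (A.29)).

Novelty: Searches (2026-08-16, this seat; local searchd reset, OpenAlex/S2 partly rate-limited — logged):
`lit search --source arxiv "anomalous dissipation forced Navier-Stokes"` (10: arXiv:2207.06301,
2212.08413, 1910.04204, 2305.08090, 2605.18126, 1803.09695 …); `… "zeroth law turbulence
Navier-Stokes"` (5: arXiv:2004.08655, 2504.13298, 1902.02032, 2111.03493); `… "Cheskidov Friedlander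
dyadic vanishing viscosity"` (2: arXiv:0810.3718, 1112.5376); `… "auxiliary functions bounds time
averages turbulence"` (2: arXiv:2010.06730, 1704.02475); `… "statistical solutions Euler vanishing
viscosity stationary"` (1: math/0611782); `lit search --source s2 "absence of anomalous dissipation
stationary statistical solutions"` (6) and `"Hopf equation stationary Euler statistical solution
enstrophy"` (8: arXiv:1606.02174, CLMP 1992/95); `lit search --source zbmath "stationary statistical
solution Euler equations"` (10: Kuksin 2004, Robert 2003); `lit search --source crossref "stationary
statistical solutions Navier-Stokes energy dissipation lower bound vanishing viscosity"` (7: FMRT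
Ch. IV, Chae 1991); `lit galaxy search "stationary statistical solution" | "zeroth law of
turbulence" --star all` (15 / 10 rows, books only); `lit read arXiv:1404.1098 --grep` (p.6 L17),
`lit read arXiv:2010.06730`, `arXiv:2004.08655`, `arXiv:2504.13298`, `arXiv:2605.18126` pp.1–2; hub:
all 43 Theses headers and item lists, the 6 negatives, 35 open + 99 closed card titles (grep virtual
dissipation / coerciv / Lamb rigid  [refs: 2207.06301, 2004.08655, 0810.3718, 2010.06730, 1606.02174, 1404.1098, 2504.13298, 2605.18126, 1305.7089]

Barriers (technique_class: statistical-solutions, virtual-dissipation, pinned-force): - technique_class: statistical-solutions, virtual-dissipation, pinned-force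
- Literature.Barriers.AnomalousDissipation.Cheskidov2023_thm13_not_forceRobustNoAnomaly: n/a in
direction (positive route) and in kind: X1 is maximally NON-robust in f (an exact dodger of a
C^∞-nearby force changes nothing for f_GP, and f_GP's rigidity changes under C^∞-small changes of
f); no estimate stable in f is used.
- Literature.Barriers.AnomalousDissipation.DrivasEyink2019_lemma1_measurable: consistent and built
in — X1 at small R with bounded G is exactly "tame (Onsager-subcritical) statistics of f_GP do not
exist", so the loud families have G_j = ε/ν_j → ∞ as the lemma requires; conceded: a uniformly
B^{σ>1/3}_3 stationary Euler statistics of f_GP refutes X1 (R G^{1/2} ≍ ℓ^{3σ−1} → 0 along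
mollifications).
- Literature.Barriers.AnomalousDissipation.BuckmasterVicol2019_thm13: evaded by the finite-enstrophy
clause — wild (non-Leray, infinite-enstrophy) steady states are not admissible measures; they
threaten only through Onsager-supercritical smooth approximants, i.e. the DrivasEyink line above;
witnesses of X2 are Leray–Hopf by definition.
- Literature.Barriers.AnomalousDissipation.BrenierDeLellisSzekelyhidi2011_cor1: n/a — finite-window,
fixed-datum weak–strong statement; here t → ∞ is taken first (time-average measures) and ν → 0 never
inside an estimate.
- Literature.Barriers.AnomalousDissipation.BrueDeLellis2023_noAnomaly_beforeEulerSingularity: n/a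
for the same reason (no finite window,

History (route lifecycle, newest last):
- 2026-08-26T16:12:49Z · DORMANT — reconciler: no traction for 6.2 d (last activity item-proof-filed at 2026-08-20T11:59:43Z); parked, not closed — `ledger route dormant route-AnomalousDissipatio (operator:999:93751)

sub-problem: AnomalousDissipation · status: dormant · opened planner-plan-lens-AnomalousDissipation-recomb-v2-0 2026-08-16T15:43:11Z · rev 4 · ledger route-AnomalousDissipation-EnsembleRigidity
GENERATED by the gate from the ledger (D-0016/17). Provers cite these decls: `theorem foo : Summit.AnomalousDissipation.AnomalousDissipation.Theses.EnsembleRigidity.<Decl> := …` in Summits/AnomalousDissipation/AnomalousDissipation/Theorems/<Name>.lean.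
-/

namespace Summit.AnomalousDissipation.AnomalousDissipation.Theses.EnsembleRigidity

open scoped BigOperators Topology Manifold Classical MeasureTheory ProbabilityTheory Matrix InnerProductSpace ComplexConjugate ContinuousMap
open Filter Set Function TopologicalSpace MeasureTheory

attribute [summit_statement] _root_.AnomalousDissipation

open Literature.Turb

/-- item stmt-AnomalousDissipation-15508 · target · rank 2 · open · by planner
why it might fail: One tame Euler statistics of f_GP kills it at its level: a bounded quiet dodger end of the GP Galerkin census (K² ∈ {6,11,12,14}, continuum fate open), a convergent Beltrami big-dodger series A·ABC⁺ + O(1/A), a C^{σ>1/3} standing flow; or IDES2025's vanishing anomaly.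
sources: arXiv:1404.1098, arXiv:0810.3718, arXiv:1305.7089, arXiv:2010.06730, arXiv:2504.13298, doi:10.1137/140957354
[crux] STATISTICAL LAMB RIGIDITY OF f_GP (new; from VirtualDissipation: the residual lever, now on
measures; from ForcedSmallScales 1434/1440 and card euler-coercive-force: the object, now
quantitative and level-wise). For every E there are c, δ₀ > 0 such that every Borel probability
measure μ on Torus.energySpace (Fin 3) with Integrable |v|², ensembleEnergy μ ≤ E, ensembleEnstrophy
μ < ⊤, non-negative work ∫_{e₁≤|v|²<e₂}(v,f_GP)dμ ≥ 0 on every energy shell, and cylindrical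
forced-Euler defect |∫ nsGeneratorPairing 0 f_GP v (Φ.grad v) dμ| ≤ R·(∫ gradNormSq (Φ.grad v)
dμ)^{1/2} for all Φ (integrand integrable), 0 ≤ R ≤ δ₀, satisfies c ≤ R·((ensembleEnstrophy
μ).toReal)^{1/2}. At a Dirac mass this is VirtualDissipation's single-field rigidity at level E
(plus (f,v) ≥ 0); at R = 0 it says f_GP carries no finite-enstrophy stationary Euler statistics of
mean energy ≤ E (the FMRT class of FSS's CyclicForceCoercive, GP orientation). [difficulty:
open-problem] -/
@[route_item "route-AnomalousDissipation-EnsembleRigidity"]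
def GPStatisticalRigidity : Prop :=
  ∀ f : UnitAddTorus (Fin 3) → EuclideanSpace ℝ (Fin 3), f = (fun x : UnitAddTorus (Fin 3) => (Literature.Analysis.FluidPDE.Torus.stokesMode (Pi.single (2 : Fin 3) (1 : ℤ)) (EuclideanSpace.single (0 : Fin 3) (1 : ℝ)) false x + Literature.Analysis.FluidPDE.Torus.stokesMode (Pi.single (0 : Fin 3) (1 : ℤ)) (EuclideanSpace.single (1 : Fin 3) (1 : ℝ)) false x + Literature.Analysis.FluidPDE.Torus.stokesMode (Pi.single (1 : Fin 3) (1 : ℤ)) (EuclideanSpace.single (2 : Fin 3) (1 : ℝ)) false x : EuclideanSpace ℝ (Fin 3))) → ∀ E : ℝ, ∃ c δ₀ : ℝ, 0 < c ∧ 0 < δ₀ ∧ ∀ μ : MeasureTheory.Measure (Literature.Analysis.FunctionSpaces.Torus.energySpace (Fin 3)), MeasureTheory.IsProbabilityMeasure μ → MeasureTheory.Integrable (fun v : Literature.Analysis.FunctionSpaces.Torus.energySpace (Fin 3) => ‖v‖ ^ 2) μ → Literature.Analysis.FluidPDE.Torus.ensembleEnergy μ ≤ E → Literature.Analysis.FluidPDE.Torus.ensembleEnstrophy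 μ < ⊤ → (∀ e₁ e₂ : ENNReal, e₁ < e₂ → 0 ≤ ∫ v in {v : Literature.Analysis.FunctionSpaces.Torus.energySpace (Fin 3) | e₁ ≤ ‖v‖ₑ ^ 2 ∧ ‖v‖ₑ ^ 2 < e₂}, Literature.Analysis.FluidPDE.Torus.pairing (v : MeasureTheory.Lp (EuclideanSpace ℝ (Fin 3)) 2 (MeasureTheory.volume : MeasureTheory.Measure (UnitAddTorus (Fin 3)))) f ∂μ) → ∀ R : ℝ, 0 ≤ R → R ≤ δ₀ → (∀ Φ : Literature.Analysis.FluidPDE.Torus.CylindricalTest (Fin 3), MeasureTheory.Integrable (fun v : Literature.Analysis.FunctionSpaces.Torus.energySpace (Fin 3) => Literature.Analysis.FluidPDE.Torus.nsGeneratorPairing 0 f v (Φ.grad v)) μ ∧ |∫ v, Literature.Analysis.FluidPDE.Torus.nsGeneratorPairing 0 f v (Φ.grad v) ∂μ| ≤ R * Real.sqrt (∫ v, Literature.Analysis.FunctionSpaces.Torus.gradNormSq (Φ.grad v) ∂μ)) → c ≤ R * Real.sqrt (Literature.Analysis.FluidPDE.Torus.ensembleEnstrophy μ).toReal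

/-- item stmt-AnomalousDissipation-17938 · crux · rank 2 · open · by planner
why it might fail: One exact TAME dodger kills it at its (E,G₁): a finite-enstrophy stationary Euler statistics of f_GP — a converged K→∞ limit of the census' steady Galerkin dodger branch (E≈1, G_min(K)=82→436 at K≤14, fate open), a ≥3-shell Beltrami cancellation, or an orbit measure of a recurrent tame Euler flow.
sources: arXiv:1404.1098, FoiasManleyRosaTemam2001, arXiv:2110.08039, arXiv:1305.7089, arXiv:2010.06730, Summits/AnomalousDissipation/AnomalousDissipation/Cruxes/GPStatisticalRigidity/Disproof.lean
[crux] T — TAME DEFECT FLOOR OF f_GP (the judge's `what_would_move_it`, 06:45Z pass: a ν-FREE LOWER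
BOUND ON THE FORCED-EULER DEFECT OF LOW-ENSTROPHY MEASURES, level-wise). For every energy level E
and mean-enstrophy level G₁ there is r = r(E,G₁) > 0 such that NO Borel probability measure μ on H =
L²_σ(T³) with Integrable |v|², ensembleEnergy μ ≤ E and ensembleEnstrophy μ ≤ G₁ has Φ-uniform
cylindrical forced-Euler defect ≤ r (i.e. ¬ ∀ Φ, |∫ nsGeneratorPairing 0 f_GP v (Φ.grad v) dμ| ≤
r·(∫ gradNormSq (Φ.grad v) dμ)^{1/2}). Strictly weaker than X = GPStatisticalRigidity (X ⇒ T with r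
= min(δ₀, c/√G₁)/2 after desaturation) and exactly the premise of R = TameToRough; the sibling
decomposition TameRoughRigidity proves T ⇐ GPEulerCoercive ∧ TameClosure (N ∧ K, the `gap` block of
Theorems.TameRoughRigidity.rigiditySplit_proof). WHY EASIER THAN X: in the tame class the Galerkin
tail is controlled by the enstrophy budget (∫|Q_K v|²dμ ≤ G₁/(4π²K²)), so T(E,G₁) reduces to ONE
finite-dimensional Liouville-defect certificate at a single truncation K = K(E,G₁) (polynomial
dynamics on P_K H, energy/enstrophy-ball moment constraints: an SOS/LP dual searchable on kit and
certifiable in exact arit -/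
@[route_item "route-AnomalousDissipation-EnsembleRigidity", crux]
def GPTameDefectFloor : Prop :=
  ∀ f : UnitAddTorus (Fin 3) → EuclideanSpace ℝ (Fin 3), f = (fun x : UnitAddTorus (Fin 3) => (Literature.Analysis.FluidPDE.Torus.stokesMode (Pi.single (2 : Fin 3) (1 : ℤ)) (EuclideanSpace.single (0 : Fin 3) (1 : ℝ)) false x + Literature.Analysis.FluidPDE.Torus.stokesMode (Pi.single (0 : Fin 3) (1 : ℤ)) (EuclideanSpace.single (1 : Fin 3) (1 : ℝ)) false x + Literature.Analysis.FluidPDE.Torus.stokesMode (Pi.single (1 : Fin 3) (1 : ℤ)) (EuclideanSpace.single (2 : Fin 3) (1 : ℝ)) false x : EuclideanSpace ℝ (Fin 3))) → ∀ E G₁ : ℝ, ∃ r : ℝ, 0 < r ∧ ∀ μ : MeasureTheory.Measure (Literature.Analysis.FunctionSpaces.Torus.energySpace (Fin 3)), MeasureTheory.IsProbabilityMeasure μ → MeasureTheory.Integrable (fun v : Literature.Analysis.FunctionSpaces.Torus.energySpace (Fin 3) => ‖v‖ ^ 2) μ → Literature.Analysis.FluidPDE.Torus.ensembleEnergy μ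 ≤ E → Literature.Analysis.FluidPDE.Torus.ensembleEnstrophy μ ≤ ENNReal.ofReal G₁ → ¬ (∀ Φ : Literature.Analysis.FluidPDE.Torus.CylindricalTest (Fin 3), MeasureTheory.Integrable (fun v : Literature.Analysis.FunctionSpaces.Torus.energySpace (Fin 3) => Literature.Analysis.FluidPDE.Torus.nsGeneratorPairing 0 f v (Φ.grad v)) μ ∧ |∫ v, Literature.Analysis.FluidPDE.Torus.nsGeneratorPairing 0 f v (Φ.grad v) ∂μ| ≤ r * Real.sqrt (∫ v, Literature.Analysis.FunctionSpaces.Torus.gradNormSq (Φ.grad v) ∂μ))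

/-- item stmt-AnomalousDissipation-15509 · crux · rank 3 · open · by planner
why it might fail: No ν-uniform mean-energy bound is known for ANY fixed 3-D force at zero momentum (a priori ⟨|u|²⟩ ≤ |f|²/(16π⁴ν²) only); every GP family might laminarise onto runaway branches (census: quiet Stokes-arc ends with ‖u‖ ≍ ν^{-1/3}), making E grow with j.
sources: DoeringFoias2002, FoiasManleyRosaTemam2001, arXiv:2311.04182, arXiv:1305.7089, Summits/AnomalousDissipation/AnomalousDissipation/Theses/Correlation.lean, Summits/AnomalousDissipation/AnomalousDissipation/Theorems/CorrelationEnergyUnboundedNegRefutation.lean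
[crux] TURBULENT SATURATION IN THE MEAN FOR f_GP (from Correlation 14641 / ForcedSmallScales 1435:
the saturation half, pinned to f_GP, weakened from pathwise to limsup-mean, momentum killed by the
H-lift as the drift refutations 2979/2984/0204 demand). There are a level E, viscosities ν_j ∈ (0,1]
with ν_j → 0, data u₀ⱼ, global Leray–Hopf solutions u_j of NS_{ν_j}(f_GP) and H-valued lifts U_j
(U_j t = u_j t a.e. for every t ≥ 0: zero momentum, weakly solenoidal slices) with meanEnergy (u_j)
≤ E for all j. Any zero-momentum bounded family — turbulent paths from rest, a bounded steady or
periodic GP branch realised as Leray–Hopf — fires it. [difficulty: open-problem] -/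
@[route_item "route-AnomalousDissipation-EnsembleRigidity", crux]
def GPMeanBoundedFamily : Prop :=
  ∀ f : UnitAddTorus (Fin 3) → EuclideanSpace ℝ (Fin 3), f = (fun x : UnitAddTorus (Fin 3) => (Literature.Analysis.FluidPDE.Torus.stokesMode (Pi.single (2 : Fin 3) (1 : ℤ)) (EuclideanSpace.single (0 : Fin 3) (1 : ℝ)) false x + Literature.Analysis.FluidPDE.Torus.stokesMode (Pi.single (0 : Fin 3) (1 : ℤ)) (EuclideanSpace.single (1 : Fin 3) (1 : ℝ)) false x + Literature.Analysis.FluidPDE.Torus.stokesMode (Pi.single (1 : Fin 3) (1 : ℤ)) (EuclideanSpace.single (2 : Fin 3) (1 : ℝ)) false x : EuclideanSpace ℝ (Fin 3))) → ∃ (E : ℝ) (ν : ℕ → ℝ) (u₀ : ℕ → UnitAddTorus (Fin 3) → EuclideanSpace ℝ (Fin 3)) (u : ℕ → ℝ → UnitAddTorus (Fin 3) → EuclideanSpace ℝ (Fin 3)) (U : ℕ → ℝ → Literature.Analysis.FunctionSpaces.Torus.energySpace (Fin 3)), (∀ j, 0 < ν j ∧ ν j ≤ 1) ∧ Filter.Tendsto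 ν Filter.atTop (nhds 0) ∧ (∀ j, Literature.Analysis.FluidPDE.Torus.IsGlobalLerayHopf (ν j) (fun _ => f) (u₀ j) (u j)) ∧ (∀ j t, 0 ≤ t → ((U j t : MeasureTheory.Lp (EuclideanSpace ℝ (Fin 3)) 2 (MeasureTheory.volume : MeasureTheory.Measure (UnitAddTorus (Fin 3)))) : UnitAddTorus (Fin 3) → EuclideanSpace ℝ (Fin 3)) =ᵐ[MeasureTheory.volume] u j t) ∧ ∀ j, Literature.Analysis.FluidPDE.meanEnergy (u j) ≤ E

/-- item stmt-AnomalousDissipation-15510 · crux · rank 4 · closed · proved by Summit.AnomalousDissipation.AnomalousDissipation.Theorems.ResidualTransferSSS.ResidualTransferSSS_of @ 45f501a4bdc4 (prover) · by planner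
why it might fail: Provable in kind; typing risks only: the spectral Green bound |(v,Δw)| ≤ ‖∇v‖‖∇w‖ for v ∈ H with eGradNormSq v < ⊤ may need a new Literature lemma (PhantomFloor.abs_integral_inner_laplacian_le is stated for smooth v).
sources: FoiasManleyRosaTemam2001, arXiv:1606.02174, Summits/AnomalousDissipation/AnomalousDissipation/Theorems/TaylorCertificatesPhantomFloorLawPairing.lean, Summits/AnomalousDissipation/AnomalousDissipation/Theses/VirtualDissipation.lean
[crux] RESIDUAL TRANSFER AT THE ENSEMBLE LEVEL (banked lever of VirtualDissipation lifted to
measures; provable now, it is the engine so it is ranked). For ν > 0, f smooth divergence-free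
mean-zero and every stationary statistical solution μ of NS_ν(f) with integrable energy: (a) the
work is non-negative on every energy shell (the FMRT shell inequality ∫_{shell}(ν‖∇v‖² − (f,v))dμ ≤
0 with ν‖∇v‖² ≥ 0, both terms integrable); (b) for every cylindrical Φ the forced-Euler generator
integrand nsGeneratorPairing 0 f v (Φ.grad v) is μ-integrable and |∫ nsGeneratorPairing 0 f v
(Φ.grad v) dμ| ≤ ν·((ensembleEnstrophy μ).toReal)^{1/2}·(∫ gradNormSq (Φ.grad v) dμ)^{1/2}. Proof:
nsGeneratorPairing ν − nsGeneratorPairing 0 = ν(v, ΔΦ'(v)) pointwise (definition); the generator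
identity (1.30) gives ∫ nsGeneratorPairing 0 = −ν∫(v,ΔΦ'(v)); spectral Green–Cauchy–Schwarz |(v,Δw)|
≤ (eGradNormSq v)^{1/2}‖∇w‖ μ-a.e. (finite enstrophy), then Cauchy–Schwarz in μ. [difficulty: M] -/
@[route_item "route-AnomalousDissipation-EnsembleRigidity", crux]
def ResidualTransferSSS : Prop :=
  ∀ (ν : ℝ) (f : UnitAddTorus (Fin 3) → EuclideanSpace ℝ (Fin 3)) (μ : MeasureTheory.Measure (Literature.Analysis.FunctionSpaces.Torus.energySpace (Fin 3))), 0 < ν → Literature.Analysis.FunctionSpaces.Torus.IsSmooth f → Literature.Analysis.FunctionSpaces.Torus.IsDivFree f → Literature.Analysis.FunctionSpaces.Torus.HasZeroMean f → Literature.Analysis.FluidPDE.Torus.IsStationaryStatisticalSolution ν f μ → MeasureTheory.Integrable (fun v : Literature.Analysis.FunctionSpaces.Torus.energySpace (Fin 3) => ‖v‖ ^ 2) μ → (∀ e₁ e₂ : ENNReal, e₁ < e₂ → 0 ≤ ∫ v in {v : Literature.Analysis.FunctionSpaces.Torus.energySpace (Fin 3) | e₁ ≤ ‖v‖ₑ ^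 2 ∧ ‖v‖ₑ ^ 2 < e₂}, Literature.Analysis.FluidPDE.Torus.pairing (v : MeasureTheory.Lp (EuclideanSpace ℝ (Fin 3)) 2 (MeasureTheory.volume : MeasureTheory.Measure (UnitAddTorus (Fin 3)))) f ∂μ) ∧ ∀ Φ : Literature.Analysis.FluidPDE.Torus.CylindricalTest (Fin 3), MeasureTheory.Integrable (fun v : Literature.Analysis.FunctionSpaces.Torus.energySpace (Fin 3) => Literature.Analysis.FluidPDE.Torus.nsGeneratorPairing 0 f v (Φ.grad v)) μ ∧ |∫ v, Literature.Analysis.FluidPDE.Torus.nsGeneratorPairing 0 f v (Φ.grad v) ∂μ| ≤ ν * Real.sqrt (Literature.Analysis.FluidPDE.Torus.ensembleEnstrophy μ).toReal * Real.sqrt (∫ v, Literature.Analysis.FunctionSpaces.Torus.gradNormSq (Φ.grad v) ∂μ)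

-- `ResidualTransferSSS` holds: proved by `Summit.AnomalousDissipation.AnomalousDissipation.Theorems.ResidualTransferSSS.ResidualTransferSSS_of` @ 45f501a4bdc4 (its module imports this route file, so no `_holds` link can be stated here).

/-- item stmt-AnomalousDissipation-15511 · crux · rank 5 · closed · proved by Summit.AnomalousDissipation.AnomalousDissipation.Theorems.EnsembleFloorTransfer_proof @ 9e2071cf94d4 (prover) · by planner
why it might fail: Provable in kind; typing risk: the limsup junk of meanEnergy/meanDissipation on unbounded Cesàro means (value 0) — harmless for Leray–Hopf paths at ν > 0 (Doering–Foias a-priori bounds in tree), but the proof must route through them.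
sources: FoiasManleyRosaTemam2001, DoeringFoias2002, Summits/AnomalousDissipation/AnomalousDissipation/Theorems/TaylorCertificatesEnsembleCeilingTransfer.lean, Literature/Analysis/FluidPDE/TimeAverageEnstrophy.lean
[crux] ENSEMBLE FLOOR ⇒ PATH FLOOR (the dissipation twin of TaylorCertificates' PROVED
EnsembleCeilingTransfer; provable now with in-tree FMRT Ch. IV machinery). For ν > 0, f smooth
divergence-free mean-zero: if every stationary statistical solution of NS_ν(f) with integrable
energy and ensembleEnergy ≤ E has ensembleDissipation ≥ ε₀, then every global Leray–Hopf u (datum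
u₀) with an H-valued lift U (U t = u t a.e., t ≥ 0) and meanEnergy u ≤ E has meanDissipation ν u ≥
ε₀. Proof: any generalized limit Λ; time-average measure μ of U (exists_timeAverageMeasure_holds); μ
is an SSS (timeAverage_isStationary_holds; force fed through its H-class as in
EnsembleCeilingTransfer_proof); ∫min(|v|²,M)dμ ≤ limsup Cesàro mean of ‖U t‖² = meanEnergy u ≤ E, M
→ ∞ gives integrability and ensembleEnergy ≤ E; ν∫min(galerkinEnstrophy_m, M)dμ ≤ limsup Cesàro mean
of ν(eGradNormSq (u t)).toReal = meanDissipation (galerkinEnstrophy ≤ eGradNormSq, finite a.e. in t;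
pattern of IsTimeAverageMeasure.lintegral_eGradNormSq_le), monotone convergence and Fatou give
ensembleDissipation ν μ ≤ meanDissipation ν u. [difficulty: L] -/
@[route_item "route-AnomalousDissipation-EnsembleRigidity", crux]
def EnsembleFloorTransfer : Prop :=
  ∀ (ν E ε₀ : ℝ) (f u₀ : UnitAddTorus (Fin 3) → EuclideanSpace ℝ (Fin 3)) (u : ℝ → UnitAddTorus (Fin 3) → EuclideanSpace ℝ (Fin 3)) (U : ℝ → Literature.Analysis.FunctionSpaces.Torus.energySpace (Fin 3)), 0 < ν → Literature.Analysis.FunctionSpaces.Torus.IsSmooth f → Literature.Analysis.FunctionSpaces.Torus.IsDivFree f → Literature.Analysis.FunctionSpaces.Torus.HasZeroMean f → (∀ μ : MeasureTheory.Measure (Literature.Analysis.FunctionSpaces.Torus.energySpace (Fin 3)), Literature.Analysis.FluidPDE.Torus.IsStationaryStatisticalSolution ν f μ → MeasureTheory.Integrable (fun v : Literature.Analysis.FunctionSpaces.Torus.energySpace (Fin 3) => ‖v‖ ^ 2) μ → Literature.Analysis.FluidPDE.Torus.ensembleEnergy μ ≤ E → ε₀ ≤ Literature.Analysis.FluidPDE.Torus.ensembleDissipation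 ν μ) → Literature.Analysis.FluidPDE.Torus.IsGlobalLerayHopf ν (fun _ => f) u₀ u → (∀ t, 0 ≤ t → ((U t : MeasureTheory.Lp (EuclideanSpace ℝ (Fin 3)) 2 (MeasureTheory.volume : MeasureTheory.Measure (UnitAddTorus (Fin 3)))) : UnitAddTorus (Fin 3) → EuclideanSpace ℝ (Fin 3)) =ᵐ[MeasureTheory.volume] u t) → Literature.Analysis.FluidPDE.meanEnergy u ≤ E → ε₀ ≤ Literature.Analysis.FluidPDE.meanDissipation ν u

-- `EnsembleFloorTransfer` holds: proved by `Summit.AnomalousDissipation.AnomalousDissipation.Theorems.EnsembleFloorTransfer_proof` @ 9e2071cf94d4 (its module imports this route file, so no `_holds` link can be stated here).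

/-- item stmt-AnomalousDissipation-18401 · crux · rank 6 · open · by planner
why it might fail: A genuinely rough violating sequence: mollifications of a B^(σ>1/3) stationary Euler statistics of f_GP with zero Duchon–Robert defect (R√G ≍ ℓ^(3σ−1) → 0), or broadband bounds decaying like N⁻² so that only G ≳ log(1/R) is forced.
sources: arXiv:1706.04113, doi:10.1007/bf02099744, arXiv:1404.1098, Literature.Barriers.AnomalousDissipation.DrivasEyink2019_lemma1_measurable, Summits/AnomalousDissipation/AnomalousDissipation/Theses/TameRoughRigidity.lean, Summits/AnomalousDissipation/AnomalousDissipation/Cruxes/GPStatisticalRigidity/Lines/Sketch.md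
[crux] R — CONDITIONAL ONSAGER CALIBRATION: IF every tame class (probability, integrable energy ≤ E,
mean enstrophy ≤ G₁) carries a cylindrical defect gap r(E,G₁) > 0 (no Φ-uniform bound |∫L₀Φ dμ| ≤
r‖∇Φ'‖_(L²(μ))), THEN for every E there are G₁, c, δ₀ > 0 such that every admissible μ (probability,
integrable energy ≤ E, finite mean enstrophy G ≥ G₁, shell work ≥ 0) with defect ≤ R ≤ δ₀ pays c ≤
R·√G. The Onsager half of X, isolated ν-free and conditioned on the gap (unconditionally it would
re-contain N by noise-faking). Line: coarse-graining ⇒ small-defect statistics are BROADBAND under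
the gap, then broadband + near-stationary ⇒ calibration (bc/TameToRough_birth.lean; bc/Specials.lean
R_special proves the conclusion at every E < 3/(4π)). [deps: GPEulerCoercive, TameClosure]
[difficulty: open-problem] -/
@[route_item "route-AnomalousDissipation-EnsembleRigidity", crux]
def TameToRough : Prop :=
  ∀ f : UnitAddTorus (Fin 3) → EuclideanSpace ℝ (Fin 3), f = (fun x : UnitAddTorus (Fin 3) => (Literature.Analysis.FluidPDE.Torus.stokesMode (Pi.single (2 : Fin 3) (1 : ℤ)) (EuclideanSpace.single (0 : Fin 3) (1 : ℝ)) false x + Literature.Analysis.FluidPDE.Torus.stokesMode (Pi.single (0 : Fin 3) (1 : ℤ)) (EuclideanSpace.single (1 : Fin 3) (1 : ℝ)) false x + Literature.Analysis.FluidPDE.Torus.stokesMode (Pi.single (1 : Fin 3) (1 : ℤ)) (EuclideanSpace.single (2 : Fin 3) (1 : ℝ)) false x : EuclideanSpace ℝ (Fin 3))) → (∀ E G₁ : ℝ, ∃ r : ℝ, 0 < r ∧ ∀ μ : MeasureTheory.Measure (Literature.Analysis.FunctionSpaces.Torus.energySpace (Fin 3)), MeasureTheory.IsProbabilityMeasure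 μ → MeasureTheory.Integrable (fun v : Literature.Analysis.FunctionSpaces.Torus.energySpace (Fin 3) => ‖v‖ ^ 2) μ → Literature.Analysis.FluidPDE.Torus.ensembleEnergy μ ≤ E → Literature.Analysis.FluidPDE.Torus.ensembleEnstrophy μ ≤ ENNReal.ofReal G₁ → ¬ (∀ Φ : Literature.Analysis.FluidPDE.Torus.CylindricalTest (Fin 3), MeasureTheory.Integrable (fun v : Literature.Analysis.FunctionSpaces.Torus.energySpace (Fin 3) => Literature.Analysis.FluidPDE.Torus.nsGeneratorPairing 0 f v (Φ.grad v)) μ ∧ |∫ v, Literature.Analysis.FluidPDE.Torus.nsGeneratorPairing 0 f v (Φ.grad v) ∂μ| ≤ r * Real.sqrt (∫ v, Literature.Analysis.FunctionSpaces.Torus.gradNormSq (Φ.grad v) ∂μ))) → ∀ E : ℝ, ∃ G₁ c δ₀ : ℝ, 0 < c ∧ 0 < δ₀ ∧ ∀ μ : MeasureTheory.Measure (Literature.Analysis.FunctionSpaces.Torus.energySpace (Fin 3)), MeasureTheory.IsProbabilityMeasure μ → MeasureTheory.Integrable (fun v : Literature.Analysis.FunctionSpaces.Torus.energySpace (Fin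 3) => ‖v‖ ^ 2) μ → Literature.Analysis.FluidPDE.Torus.ensembleEnergy μ ≤ E → Literature.Analysis.FluidPDE.Torus.ensembleEnstrophy μ < ⊤ → ENNReal.ofReal G₁ ≤ Literature.Analysis.FluidPDE.Torus.ensembleEnstrophy μ → (∀ e₁ e₂ : ENNReal, e₁ < e₂ → 0 ≤ ∫ v in {v : Literature.Analysis.FunctionSpaces.Torus.energySpace (Fin 3) | e₁ ≤ ‖v‖ₑ ^ 2 ∧ ‖v‖ₑ ^ 2 < e₂}, Literature.Analysis.FluidPDE.Torus.pairing (v : MeasureTheory.Lp (EuclideanSpace ℝ (Fin 3)) 2 (MeasureTheory.volume : MeasureTheory.Measure (UnitAddTorus (Fin 3)))) f ∂μ) → ∀ R : ℝ, 0 ≤ R → R ≤ δ₀ → (∀ Φ : Literature.Analysis.FluidPDE.Torus.CylindricalTest (Fin 3), MeasureTheory.Integrable (fun v : Literature.Analysis.FunctionSpaces.Torus.energySpace (Fin 3) => Literature.Analysis.FluidPDE.Torus.nsGeneratorPairing 0 f v (Φ.grad v)) μ ∧ |∫ v, Literature.Analysis.FluidPDE.Torus.nsGeneratorPairing 0 f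 v (Φ.grad v) ∂μ| ≤ R * Real.sqrt (∫ v, Literature.Analysis.FunctionSpaces.Torus.gradNormSq (Φ.grad v) ∂μ)) → c ≤ R * Real.sqrt (Literature.Analysis.FluidPDE.Torus.ensembleEnstrophy μ).toReal

/-- item stmt-AnomalousDissipation-17939 · support · rank 9 · open · by planner
sources: FoiasManleyRosaTemam2001, Summits/AnomalousDissipation/AnomalousDissipation/Theorems/TameRoughRigidityRigiditySplit.lean
[support] the typed split T → R → X, PROVED (planner's Sketch.lean `tameSplit` / the `have hX` block
of `closes`, lean check rc 0, 0 sorry, axioms propext·Classical.choice·Quot.sound; ≈ 15 tactic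
lines: R fed with T gives the calibration above its threshold G₁(E), T at (E, G₁(E)) gives the gap
r, δ₀' = min δ₀ (r/2) makes the tame case vacuous — the patching half of
Theorems.TameRoughRigidity.rigiditySplit_proof). A prover lands it verbatim
(Theorems/EnsembleRigidityTameSplit.lean). [difficulty: provable-now] -/
@[route_item "route-AnomalousDissipation-EnsembleRigidity"]
def TameSplit : Prop :=
  GPTameDefectFloor → TameToRough → GPStatisticalRigidity

/-- item stmt-AnomalousDissipation-15512 · assembly · rank 1 · closed · proved by Summit.AnomalousDissipation.AnomalousDissipation.Theorems.ensembleRigidity_assembly_proof @ 932a912674f1 (prover) · by planner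
sources: FoiasManleyRosaTemam2001, DoeringFoias2002
[assembly] GPStatisticalRigidity → GPMeanBoundedFamily → ResidualTransferSSS → EnsembleFloorTransfer
→ AnomalousDissipation. -/
@[route_item "route-AnomalousDissipation-EnsembleRigidity"]
def Assembly : Prop :=
  GPStatisticalRigidity → GPMeanBoundedFamily → ResidualTransferSSS → EnsembleFloorTransfer → _root_.AnomalousDissipation

-- `Assembly` holds: proved by `Summit.AnomalousDissipation.AnomalousDissipation.Theorems.ensembleRigidity_assembly_proof` @ 932a912674f1 (its module imports this route file, so no `_holds` link can be stated here).

/-! D-0027 §2.1 — DECIDING THEOREM (planner-authored via `route open/edit --closes-file`; by planner-rrepair-AnomalousDissipation-EnsembleR-fbdf0fd8-0 2026-08-17T08:55:49Z):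
its hypotheses are this route's items and its conclusion the sub-problem Statement (glue_lint), and it elaborates with this file. -/

@[closes "route-AnomalousDissipation-EnsembleRigidity"] theorem closes (h₁ : GPTameDefectFloor) (h₂ : TameToRough) (h₃ : GPMeanBoundedFamily)
    (h₄ : ResidualTransferSSS) (h₅ : EnsembleFloorTransfer) : _root_.AnomalousDissipation := by
  -- judge-repair (2026-08-17): X = GPStatisticalRigidity is DERIVED from the tame defect floor (T, h₁)
  -- and the conditional Onsager calibration (R, h₂): R fed with T calibrates above its threshold
  -- G₁(E); T at (E, G₁(E)) gives the gap r; δ₀' = min δ₀ (r/2) makes the tame case vacuous.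
  -- (This block is the support item `TameSplit`, proved here inline and verbatim in the planner's Sketch.lean.)
  have hX : GPStatisticalRigidity := by
    intro f hf E
    obtain ⟨G₁, c, δ₀, hc, hδ₀, hrough⟩ := h₂ f hf (h₁ f hf) E
    obtain ⟨r, hr, hgap⟩ := h₁ f hf E G₁
    refine ⟨c, min δ₀ (r / 2), hc, lt_min hδ₀ (by linarith), ?_⟩
    intro μ hprob hint hE hfin hshell R hR0 hRle hdef
    by_cases hcase : ENNReal.ofReal G₁ ≤ Literature.Analysis.FluidPDE.Torus.ensembleEnstrophy μ
    · exact hrough μ hprob hint hE hfin hcase hshell R hR0 (hRle.trans (min_le_left _ _)) hdef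
    · exfalso
      have htame : Literature.Analysis.FluidPDE.Torus.ensembleEnstrophy μ ≤ ENNReal.ofReal G₁ :=
        (not_le.mp hcase).le
      refine hgap μ hprob hint hE htame ?_
      intro Φ
      obtain ⟨hi, hb⟩ := hdef Φ
      refine ⟨hi, hb.trans ?_⟩
      have hRr : R ≤ r := hRle.trans ((min_le_right _ _).trans (by linarith))
      exact mul_le_mul_of_nonneg_right hRr (Real.sqrt_nonneg _)
  -- the pinned force and its admissibility (landed Theorems fact)
  set fGP : UnitAddTorus (Fin 3) → EuclideanSpace ℝ (Fin 3) := fun x : UnitAddTorus (Fin 3) =>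
    (Literature.Analysis.FluidPDE.Torus.stokesMode (Pi.single (2 : Fin 3) (1 : ℤ)) (EuclideanSpace.single (0 : Fin 3) (1 : ℝ)) false x +
      Literature.Analysis.FluidPDE.Torus.stokesMode (Pi.single (0 : Fin 3) (1 : ℤ)) (EuclideanSpace.single (1 : Fin 3) (1 : ℝ)) false x +
      Literature.Analysis.FluidPDE.Torus.stokesMode (Pi.single (1 : Fin 3) (1 : ℤ)) (EuclideanSpace.single (2 : Fin 3) (1 : ℝ)) false x :
      EuclideanSpace ℝ (Fin 3)) with hfGP
  obtain ⟨hsm, hdf, hzm⟩ :=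
    Summit.AnomalousDissipation.AnomalousDissipation.Theorems.SteadyStatesLoudBounded.GpAdmissible.stub_gpAdmissible
  -- crux 3: the mean-bounded lifted family
  obtain ⟨E, ν, u₀, u, U, hν, hν0, hLH, hU, hE⟩ := h₃ fGP hfGP
  -- crux 2: rigidity constants at level E
  obtain ⟨c, δ₀, hc, hδ₀, hrig⟩ := hX fGP hfGP E
  set ε₀ : ℝ := min c (δ₀ ^ 2) with hε₀
  have hε₀pos : 0 < ε₀ := lt_min hc (pow_pos hδ₀ 2)
  -- ensemble floor at level E, for every viscosity in (0,1]
  have floor : ∀ ν' : ℝ, 0 < ν' → ν' ≤ 1 →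
      ∀ μ : MeasureTheory.Measure (Literature.Analysis.FunctionSpaces.Torus.energySpace (Fin 3)),
        Literature.Analysis.FluidPDE.Torus.IsStationaryStatisticalSolution ν' fGP μ →
        MeasureTheory.Integrable (fun v : Literature.Analysis.FunctionSpaces.Torus.energySpace (Fin 3) => ‖v‖ ^ 2) μ →
        Literature.Analysis.FluidPDE.Torus.ensembleEnergy μ ≤ E →
        ε₀ ≤ Literature.Analysis.FluidPDE.Torus.ensembleDissipation ν' μ := by
    intro ν' hν' hν'1 μ hμ hint hEμ
    have hfin : Literature.Analysis.FluidPDE.Torus.ensembleEnstrophy μ < ⊤ := hμ.enstrophy_finite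
    obtain ⟨hshell, hres⟩ := h₄ ν' fGP μ hν' hsm hdf hzm hμ hint
    set G : ℝ := (Literature.Analysis.FluidPDE.Torus.ensembleEnstrophy μ).toReal with hG
    have hG0 : 0 ≤ G := ENNReal.toReal_nonneg
    have hsq : Real.sqrt G * Real.sqrt G = G := Real.mul_self_sqrt hG0
    set R : ℝ := ν' * Real.sqrt G with hR
    have hR0 : 0 ≤ R := mul_nonneg hν'.le (Real.sqrt_nonneg _)
    have hdiss : Literature.Analysis.FluidPDE.Torus.ensembleDissipation ν' μ = ν' * G := rfl
    rw [hdiss]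
    by_cases hRδ : R ≤ δ₀
    · -- rigidity branch: c ≤ R √G = ν' G
      have key := hrig μ hμ.prob hint hEμ hfin hshell R hR0 hRδ
        (fun Φ => ⟨(hres Φ).1, by simpa [hR, mul_assoc] using (hres Φ).2⟩)
      have : R * Real.sqrt G = ν' * G := by rw [hR, mul_assoc, hsq]
      calc ε₀ ≤ c := min_le_left _ _
        _ ≤ R * Real.sqrt G := key
        _ = ν' * G := this
    · -- large-residual branch: ν' G = R² / ν' ≥ R² > δ₀²
      have hRgt : δ₀ < R := lt_of_not_ge hRδ
      have hR2 : δ₀ ^ 2 < R ^ 2 := by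
        have := hδ₀.le
        nlinarith
      have hRsq : R ^ 2 = ν' * (ν' * G) := by
        have hsq2 : Real.sqrt G ^ 2 = G := Real.sq_sqrt hG0
        calc R ^ 2 = ν' ^ 2 * Real.sqrt G ^ 2 := by rw [hR]; ring
          _ = ν' * (ν' * G) := by rw [hsq2]; ring
      have hνG0 : 0 ≤ ν' * G := mul_nonneg hν'.le hG0
      have hle : R ^ 2 ≤ ν' * G := by
        rw [hRsq]
        calc ν' * (ν' * G) ≤ 1 * (ν' * G) := by
              exact mul_le_mul_of_nonneg_right hν'1 hνG0
          _ = ν' * G := one_mul _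
      calc ε₀ ≤ δ₀ ^ 2 := min_le_right _ _
        _ ≤ R ^ 2 := hR2.le
        _ ≤ ν' * G := hle
  -- path floor along the family (crux 5), then the summit witnesses
  have hdissj : ∀ j, ε₀ ≤ Literature.Analysis.FluidPDE.meanDissipation (ν j) (u j) := fun j =>
    h₅ (ν j) E ε₀ fGP (u₀ j) (u j) (U j) (hν j).1 hsm hdf hzm (floor (ν j) (hν j).1 (hν j).2)
      (hLH j) (hU j) (hE j)
  exact ⟨fGP, hsm, hdf, hzm, ν, u₀, u, fun j => (hν j).1, hν0, hLH, ⟨E, hE⟩, ε₀, hε₀pos, hdissj⟩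

end Summit.AnomalousDissipation.AnomalousDissipation.Theses.EnsembleRigidity
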